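import Summits.QuantumFields.GaugeBoot.WeakCouplingLimit
import Literature.MathematicalPhysics.QuantumLattice.SU2HaarSmallBall
import HarnessLib

/-!
# Gauge-boot: an unconditional weak-coupling RATE for `SU(2)` on every fixed torus —
# `1 − ⟨ū_P⟩_{β,L} = O_L(log β / β)` (large-`N` supplement 17, part 9)

HONEST FRAMING (cell `pub-gaugeboot`, page 1 of every file): certified bounds on lattice
expectations at STATED coupling, gauge group, dimension and torus size; NOT a mass gap, NOT a
continuum limit, NOT a string tension, NOT large `N`; NOT Yang–Mills-summit-bearing (barriers
`FixedCouplingUltralocality`, `PerturbativeInvisibility`).  The constants below grow with the torus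
(`|E|`, `#P`): this is a FIXED-torus statement, with no uniformity in `L` and the wrong power of
`log β` (the truth is `O(1/β)` by equipartition); it certifies no number of the cell's tables.

## Content

The small-ball hypothesis of `WeakCouplingLimit.wilsonExpectation_wilsonAction_le_of_smallBall` is
DISCHARGED for `SU(2)` (fundamental representation), with explicit constants:

* quaternion bookkeeping (the lane's `SU2Haar` model): `star_quatMatrix`; for unit quaternions
  `2 − 2 re q = ‖q − 1‖²` (`two_sub_two_re_eq_norm_sub_one_sq`), `‖ab − 1‖ ≤ ‖a − 1‖ + ‖b − 1‖`
  (`norm_mul_sub_one_le`), `‖q̄ − 1‖ = ‖q − 1‖` (isometry);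
* ★ `two_sub_re_trace_plaquette_le` — for `U₁,…,U₄ ∈ SU(2)`:
  `2 − Re tr(U₁U₂U₃⁻¹U₄⁻¹) ≤ 4·Σᵢ (2 − Re tr Uᵢ)` (the plaquette cost is controlled by the link costs);
  `wilsonAction_le_of_links` — if every link has `2 − Re tr U_e ≤ η` then `S(U) ≤ 16·#P·η`;
* ★★ `le_measureReal_wilsonAction_le` — the SMALL-BALL BOUND: for `0 < ε ≤ 1`,
  `Haar^{⊗E}{S ≤ ε} ≥ (4096·#P²)^{−|E|} · ε^{2|E|}` (product of the lane's one-link bound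
  `le_haarProbability_su2_two_sub_trace_le`: `Haar{2 − Re tr U ≤ η} ≥ η²/16`, `η = ε/(16 #P)`);
* ★★★ `su2_wilsonExpectation_wilsonAction_le` — for every torus and every tree coupling `β ≥ 1`:
  `⟨S⟩_{β,L} ≤ (2 + 4|E| log β + 2|E| log(4096·#P²)) / β`;
  ★★★ `one_sub_plaquetteExpectation_two_le` — in the cell's vocabulary, for `D ≥ 2`, `β_std ≥ 2`:
  `1 − plaquetteExpectation 2 D L β_std ≤ (2 + 4|E| log(β_std/2) + 2|E| log(4096·#P²)) / (β_std · #P)`.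

[folklore] (Laplace principle with an explicit small-ball estimate; Chatterjee arXiv:2401.10507 Lemma 5.5
uses the same one-link bound.)
-/

noncomputable section

open MeasureTheory Filter Topology Quaternion
open Literature.MathematicalPhysics.QuantumFieldTheory
open Literature.MathematicalPhysics.QuantumLattice (quatMatrix quatMatrix_mul su2Quat quatMatrix_su2Quat norm_su2Quat
  trace_quatMatrix_re sq_norm_eq_sum_sq le_haarProbability_su2_two_sub_trace_le fundamentalRep_apply)

namespace Summit.QuantumFields.GaugeBoot

namespace SU2Rate

/-! ## Quaternion bookkeeping -/

/-- `(quatMatrix q)⋆ = quatMatrix q̄`. [folklore] -/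
theorem star_quatMatrix (q : ℍ) : star (quatMatrix q) = quatMatrix (star q) := by
  ext i j
  fin_cases i <;> fin_cases j <;> apply Complex.ext <;> simp [quatMatrix, Matrix.star_apply]

/-- For a unit quaternion, `2 − 2 re q = ‖q − 1‖²`. [folklore] -/
theorem two_sub_two_re_eq_norm_sub_one_sq (q : ℍ) (hq : ‖q‖ = 1) : 2 - 2 * q.re = ‖q - 1‖ ^ 2 := by
  have h := sq_norm_eq_sum_sq q
  rw [hq, one_pow] at h
  rw [sq_norm_eq_sum_sq]
  simp only [Quaternion.re_sub, Quaternion.imI_sub, Quaternion.imJ_sub, Quaternion.imK_sub, Quaternion.re_one,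
    Quaternion.imI_one, Quaternion.imJ_one, Quaternion.imK_one, sub_zero]
  linear_combination h

/-- `‖ab − 1‖ ≤ ‖a − 1‖ + ‖b − 1‖` when `‖b‖ = 1` (`ab − 1 = (a − 1)b + (b − 1)`, multiplicative norm). [folklore] -/
theorem norm_mul_sub_one_le (a b : ℍ) (hb : ‖b‖ = 1) : ‖a * b - 1‖ ≤ ‖a - 1‖ + ‖b - 1‖ := by
  have h : a * b - 1 = (a - 1) * b + (b - 1) := by noncomm_ring
  rw [h]
  calc ‖(a - 1) * b + (b - 1)‖ ≤ ‖(a - 1) * b‖ + ‖b - 1‖ := norm_add_le _ _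
    _ = ‖a - 1‖ + ‖b - 1‖ := by rw [norm_mul, hb, mul_one]

/-- `‖q̄‖ = 1` for a unit quaternion. [folklore] -/
theorem norm_star_eq_one {q : ℍ} (hq : ‖q‖ = 1) : ‖star q‖ = 1 := by rw [Quaternion.norm_star, hq]

/-! ## The plaquette cost is controlled by the four link costs -/

/-- For `U ∈ SU(2)`: `2 − Re tr U = ‖su2Quat U − 1‖²`. [folklore] -/
theorem two_sub_re_trace_eq_norm_sq (U : SU 2) :
    2 - ((U : Matrix (Fin 2) (Fin 2) ℂ).trace).re = ‖su2Quat U - 1‖ ^ 2 := by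
  rw [← two_sub_two_re_eq_norm_sub_one_sq _ (norm_su2Quat U), ← quatMatrix_su2Quat U, trace_quatMatrix_re]

/-- The plaquette product of four `SU(2)` links as one quaternion matrix. [folklore] -/
theorem coe_plaquette_eq_quatMatrix (U₁ U₂ U₃ U₄ : SU 2) :
    ((U₁ * U₂ * U₃⁻¹ * U₄⁻¹ : SU 2) : Matrix (Fin 2) (Fin 2) ℂ) =
      quatMatrix (su2Quat U₁ * su2Quat U₂ * star (su2Quat U₃) * star (su2Quat U₄)) := by
  show (U₁ : Matrix (Fin 2) (Fin 2) ℂ) * U₂ * star (U₃ : Matrix (Fin 2) (Fin 2) ℂ) * star (U₄ : Matrix (Fin 2) (Fin 2) ℂ) = _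
  rw [← quatMatrix_su2Quat U₁, ← quatMatrix_su2Quat U₂, ← quatMatrix_su2Quat U₃, ← quatMatrix_su2Quat U₄,
    star_quatMatrix, star_quatMatrix, ← quatMatrix_mul, ← quatMatrix_mul, ← quatMatrix_mul]

/-- ★ **Link costs control the plaquette cost**: `2 − Re tr(U₁U₂U₃⁻¹U₄⁻¹) ≤ 4 Σᵢ (2 − Re tr Uᵢ)` in `SU(2)`. [folklore] -/
theorem two_sub_re_trace_plaquette_le (U₁ U₂ U₃ U₄ : SU 2) :
    2 - (((U₁ * U₂ * U₃⁻¹ * U₄⁻¹ : SU 2) : Matrix (Fin 2) (Fin 2) ℂ).trace).re ≤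
      4 * ((2 - ((U₁ : Matrix (Fin 2) (Fin 2) ℂ).trace).re) + (2 - ((U₂ : Matrix (Fin 2) (Fin 2) ℂ).trace).re)
        + (2 - ((U₃ : Matrix (Fin 2) (Fin 2) ℂ).trace).re) + (2 - ((U₄ : Matrix (Fin 2) (Fin 2) ℂ).trace).re)) := by
  set q₁ := su2Quat U₁
  set q₂ := su2Quat U₂
  set q₃ := su2Quat U₃
  set q₄ := su2Quat U₄
  have h₁ : ‖q₁‖ = 1 := norm_su2Quat U₁
  have h₂ : ‖q₂‖ = 1 := norm_su2Quat U₂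
  have h₃ : ‖q₃‖ = 1 := norm_su2Quat U₃
  have h₄ : ‖q₄‖ = 1 := norm_su2Quat U₄
  set Q := q₁ * q₂ * star q₃ * star q₄ with hQ
  have hQn : ‖Q‖ = 1 := by rw [hQ, norm_mul, norm_mul, norm_mul, h₁, h₂, norm_star_eq_one h₃, norm_star_eq_one h₄]; norm_num
  rw [coe_plaquette_eq_quatMatrix, trace_quatMatrix_re, two_sub_two_re_eq_norm_sub_one_sq Q hQn,
    two_sub_re_trace_eq_norm_sq, two_sub_re_trace_eq_norm_sq, two_sub_re_trace_eq_norm_sq, two_sub_re_trace_eq_norm_sq]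
  -- `‖Q − 1‖ ≤ s₁ + s₂ + s₃ + s₄`
  have hle : ‖Q - 1‖ ≤ ‖q₁ - 1‖ + ‖q₂ - 1‖ + ‖q₃ - 1‖ + ‖q₄ - 1‖ := by
    calc ‖Q - 1‖ ≤ ‖q₁ * q₂ * star q₃ - 1‖ + ‖star q₄ - 1‖ := norm_mul_sub_one_le _ _ (norm_star_eq_one h₄)
      _ ≤ ‖q₁ * q₂ - 1‖ + ‖star q₃ - 1‖ + ‖star q₄ - 1‖ := by
          gcongr; exact norm_mul_sub_one_le _ _ (norm_star_eq_one h₃)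
      _ ≤ ‖q₁ - 1‖ + ‖q₂ - 1‖ + ‖star q₃ - 1‖ + ‖star q₄ - 1‖ := by
          gcongr; exact norm_mul_sub_one_le _ _ h₂
      _ = ‖q₁ - 1‖ + ‖q₂ - 1‖ + ‖q₃ - 1‖ + ‖q₄ - 1‖ := by
          -- `‖q̄ − 1‖ = ‖q − 1‖` (the tree's `…ConstTube.norm_star_sub_one`, inlined: `star` is an isometry fixing `1`)
          rw [← Quaternion.norm_star (q₃ - 1), ← Quaternion.norm_star (q₄ - 1), star_sub, star_sub, star_one]
  have h0 : 0 ≤ ‖Q - 1‖ := norm_nonneg _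
  nlinarith [hle, h0, norm_nonneg (q₁ - 1), norm_nonneg (q₂ - 1), norm_nonneg (q₃ - 1), norm_nonneg (q₄ - 1),
    sq_nonneg (‖q₁ - 1‖ - ‖q₂ - 1‖), sq_nonneg (‖q₁ - 1‖ - ‖q₃ - 1‖), sq_nonneg (‖q₁ - 1‖ - ‖q₄ - 1‖),
    sq_nonneg (‖q₂ - 1‖ - ‖q₃ - 1‖), sq_nonneg (‖q₂ - 1‖ - ‖q₄ - 1‖), sq_nonneg (‖q₃ - 1‖ - ‖q₄ - 1‖)]

/-! ## The Wilson action under small link costs -/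

section Torus

variable {d L : ℕ}

/-- **If every link has cost `2 − Re tr U_e ≤ η` then `S(U) ≤ 16·η·#P`** (`SU(2)`, fundamental). [folklore] -/
theorem wilsonAction_le_of_links [NeZero L] (U : GaugeConfig d L (SU 2)) {η : ℝ}
    (hU : ∀ e : Edge d L, 2 - (((U e : SU 2)) : Matrix (Fin 2) (Fin 2) ℂ).trace.re ≤ η) :
    wilsonAction (suRep 2) U ≤ 16 * η * (Fintype.card (Plaquette d L) : ℝ) := by
  unfold wilsonAction
  have hterm : ∀ p : Plaquette d L,
      ((2 : ℕ) : ℝ) - ((suRep 2) (plaquetteHolonomy U p.1 p.2.1.1 p.2.1.2)).trace.re ≤ 16 * η := by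
    intro p
    rw [fundamentalRep_apply, plaquetteHolonomy, Nat.cast_ofNat]
    have h := two_sub_re_trace_plaquette_le (U (p.1, p.2.1.1)) (U (p.1.shift p.2.1.1, p.2.1.2))
      (U (p.1.shift p.2.1.2, p.2.1.1)) (U (p.1, p.2.1.2))
    have e1 := hU (p.1, p.2.1.1)
    have e2 := hU (p.1.shift p.2.1.1, p.2.1.2)
    have e3 := hU (p.1.shift p.2.1.2, p.2.1.1)
    have e4 := hU (p.1, p.2.1.2)
    linarith
  calc ∑ p : Plaquette d L, (((2 : ℕ) : ℝ) - ((suRep 2) (plaquetteHolonomy U p.1 p.2.1.1 p.2.1.2)).trace.re)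
      ≤ ∑ _p : Plaquette d L, 16 * η := Finset.sum_le_sum fun p _ => hterm p
    _ = 16 * η * (Fintype.card (Plaquette d L) : ℝ) := by rw [Finset.sum_const, Finset.card_univ, nsmul_eq_mul]; ring

/-- ★★ **The small-ball bound for `SU(2)`**: for `0 < ε ≤ 1`,
`(4096·#P²)^{−|E|}·ε^{2|E|} ≤ Haar^{⊗E}{S ≤ ε}` on every torus with plaquettes. [folklore] -/
theorem le_measureReal_wilsonAction_le [NeZero L] [Nonempty (Plaquette d L)] {ε : ℝ} (hε0 : 0 < ε) (hε1 : ε ≤ 1) :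
    ((4096 : ℝ) * (Fintype.card (Plaquette d L) : ℝ) ^ 2)⁻¹ ^ Fintype.card (Edge d L) * ε ^ (2 * Fintype.card (Edge d L)) ≤
      (Measure.pi fun _ : Edge d L => haarProbability (SU 2)).real
        {U : GaugeConfig d L (SU 2) | wilsonAction (suRep 2) U ≤ ε} := by
  haveI : IsProbabilityMeasure (haarProbability (SU 2)) :=
    ⟨by simpa [haarProbability] using Measure.haarMeasure_self (G := SU 2) (K₀ := ⊤)⟩
  set P : ℝ := (Fintype.card (Plaquette d L) : ℝ) with hPdef
  have hP : (1 : ℝ) ≤ P := by rw [hPdef]; exact_mod_cast Fintype.card_pos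
  set η : ℝ := ε / (16 * P) with hη
  have hη0 : 0 < η := by positivity
  have hη4 : η ≤ 1 / 4 := by
    rw [hη, div_le_iff₀ (by positivity)]; nlinarith
  set T : Set (SU 2) := {g : SU 2 | 2 - ((g : Matrix (Fin 2) (Fin 2) ℂ).trace).re ≤ η} with hT
  set A : Set (GaugeConfig d L (SU 2)) := Set.pi Set.univ fun _ : Edge d L => T with hA
  set π₀ := Measure.pi fun _ : Edge d L => haarProbability (SU 2) with hπ₀
  -- `A ⊆ {S ≤ ε}`
  have hsub : A ⊆ {U : GaugeConfig d L (SU 2) | wilsonAction (suRep 2) U ≤ ε} := by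
    intro U hUA
    have hU : ∀ e : Edge d L, 2 - (((U e : SU 2)) : Matrix (Fin 2) (Fin 2) ℂ).trace.re ≤ η := fun e => hUA e (Set.mem_univ e)
    have h := wilsonAction_le_of_links U hU
    have : 16 * η * P = ε := by rw [hη]; field_simp
    show wilsonAction (suRep 2) U ≤ ε
    rw [← this]; exact h
  -- `π₀ A = Haar(T)^{|E|} ≥ (η²/16)^{|E|}`
  have hπA : ENNReal.ofReal ((η ^ 2 / 16) ^ Fintype.card (Edge d L)) ≤ π₀ A := by
    rw [hπ₀, hA, Measure.pi_pi, Finset.prod_const, Finset.card_univ, ENNReal.ofReal_pow (by positivity)]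
    exact pow_le_pow_left' (le_haarProbability_su2_two_sub_trace_le hη0 hη4) _
  have hfin : π₀ {U : GaugeConfig d L (SU 2) | wilsonAction (suRep 2) U ≤ ε} ≠ ⊤ := measure_ne_top _ _
  have hreal : (η ^ 2 / 16) ^ Fintype.card (Edge d L) ≤ π₀.real {U : GaugeConfig d L (SU 2) | wilsonAction (suRep 2) U ≤ ε} := by
    rw [measureReal_def, ← ENNReal.ofReal_le_iff_le_toReal hfin]
    exact hπA.trans (measure_mono hsub)
  -- arithmetic: `(η²/16)^{|E|} = (4096 P²)^{-|E|} ε^{2|E|}`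
  have harith : ((4096 : ℝ) * P ^ 2)⁻¹ ^ Fintype.card (Edge d L) * ε ^ (2 * Fintype.card (Edge d L)) =
      (η ^ 2 / 16) ^ Fintype.card (Edge d L) := by
    rw [pow_mul, ← mul_pow]
    congr 1
    rw [hη]
    field_simp
    ring
  rw [harith]
  exact hreal

/-- ★★★ **Weak-coupling rate for `SU(2)`**: on every torus with plaquettes and for every tree coupling
`β ≥ 1`: `⟨S⟩_{β,L} ≤ (2 + 4|E|·log β + 2|E|·log(4096·#P²)) / β`. [folklore] -/
theorem su2_wilsonExpectation_wilsonAction_le [NeZero L] [Nonempty (Plaquette d L)] {β : ℝ} (hβ : 1 ≤ β) :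
    wilsonExpectation (suRep 2) β (wilsonAction (d := d) (L := L) (G := SU 2) (suRep 2)) ≤
      (2 + 4 * Fintype.card (Edge d L) * Real.log β
        + 2 * Fintype.card (Edge d L) * Real.log (4096 * (Fintype.card (Plaquette d L) : ℝ) ^ 2)) / β := by
  have hc : (0 : ℝ) < ((4096 : ℝ) * (Fintype.card (Plaquette d L) : ℝ) ^ 2)⁻¹ ^ Fintype.card (Edge d L) := by
    have : (0 : ℝ) < Fintype.card (Plaquette d L) := by exact_mod_cast Fintype.card_pos
    positivity
  have h := wilsonExpectation_wilsonAction_le_of_smallBall (d := d) (L := L) (suRep 2) (continuous_suRep 2) hc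
    (k := 2 * Fintype.card (Edge d L)) (fun ε hε0 hε1 => le_measureReal_wilsonAction_le (d := d) (L := L) hε0 hε1) hβ
  have hlog : Real.log (((4096 : ℝ) * (Fintype.card (Plaquette d L) : ℝ) ^ 2)⁻¹ ^ Fintype.card (Edge d L)) =
      -(Fintype.card (Edge d L) * Real.log (4096 * (Fintype.card (Plaquette d L) : ℝ) ^ 2)) := by
    rw [Real.log_pow, Real.log_inv]; ring
  rw [hlog] at h
  have hβ0 : 0 < β := by linarith
  refine h.trans (le_of_eq ?_)
  congr 1
  push_cast
  ring

/-- ★★★ **The cell's form**: for `SU(2)`, `D ≥ 2`, every `L` and every `β_std ≥ 2`,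
`1 − plaquetteExpectation 2 D L β_std ≤ (2 + 4|E| log(β_std/2) + 2|E| log(4096·#P²)) / (β_std · #P)`
(`|E| = D·L^D` links, `#P = D(D−1)/2·L^D` plaquettes). [folklore] -/
theorem one_sub_plaquetteExpectation_two_le {D L : ℕ} [NeZero L] (hD : 2 ≤ D) {β : ℝ} (hβ : 2 ≤ β) :
    1 - plaquetteExpectation 2 D L β ≤
      (2 + 4 * Fintype.card (Edge D L) * Real.log (β / 2)
        + 2 * Fintype.card (Edge D L) * Real.log (4096 * (Fintype.card (Plaquette D L) : ℝ) ^ 2)) /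
        (β * Fintype.card (Plaquette D L)) := by
  haveI := nonempty_plaquette_of_two_le (L := L) hD
  have hc : (0 : ℝ) < ((4096 : ℝ) * (Fintype.card (Plaquette D L) : ℝ) ^ 2)⁻¹ ^ Fintype.card (Edge D L) := by
    have : (0 : ℝ) < Fintype.card (Plaquette D L) := by exact_mod_cast Fintype.card_pos
    positivity
  have hβ' : (1 : ℝ) ≤ β / (2 : ℕ) := by rw [Nat.cast_ofNat, le_div_iff₀ (by norm_num : (0 : ℝ) < 2)]; linarith
  have h := one_sub_wilsonExpectation_meanPlaquette_le_of_smallBall (d := D) (L := L) (suRep 2) (continuous_suRep 2)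
    (by norm_num : (2 : ℕ) ≠ 0) hc (k := 2 * Fintype.card (Edge D L))
    (fun ε hε0 hε1 => le_measureReal_wilsonAction_le (d := D) (L := L) hε0 hε1) hβ'
  have hlog : Real.log (((4096 : ℝ) * (Fintype.card (Plaquette D L) : ℝ) ^ 2)⁻¹ ^ Fintype.card (Edge D L)) =
      -(Fintype.card (Edge D L) * Real.log (4096 * (Fintype.card (Plaquette D L) : ℝ) ^ 2)) := by
    rw [Real.log_pow, Real.log_inv]; ring
  rw [hlog] at h
  unfold plaquetteExpectation
  refine h.trans (le_of_eq ?_)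
  have hP : (0 : ℝ) < Fintype.card (Plaquette D L) := by exact_mod_cast Fintype.card_pos
  have hβ0 : 0 < β := by linarith
  push_cast
  field_simp
  ring

end Torus

end SU2Rate

end Summit.QuantumFields.GaugeBoot

end
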